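import Mathlib.LinearAlgebra.RootSystem.Base
import Mathlib.LinearAlgebra.RootSystem.Reduced
import Literature.NumberTheory.Automorphic.PosRootGroupProduct
import Literature.NumberTheory.Automorphic.ReductiveDualChevalleyBasedProofs
import HarnessLib

/-!
# A regular coweight for a base: `⟨α, ∑_{β > 0} β^∨⟩ = 2 ht(α)`
(trunk T-AUTOMORPHIC, G25 AutomorphicL)

Bridge between the two ways positive systems appear in this topic: Mathlib's bases
`b : P.Base` with `b.IsPos`, `b.height` (used by `borelOfBase`,
`ReductiveDualChevalleyBasedProofs.lean`, and by `RootSubgroupCommutators.lean`) and the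
regular coweights `y` with `R⁺(y) = {α | ⟨α, y⟩ > 0}` (Springer 7.4.5; used by `posRootGroup`,
`BigCellReduction.lean`, `RootProductRetraction.lean`, `PosRootGroupProduct.lean`).

* `RootPairing.Base.twoRhoCoroot b = ∑_{β > 0} β^∨ ∈ N` (definition, over any `[CharZero R]`;
  the coroot-side twin of the tree's `RootPairing.Base.twoRho b = ∑_{α > 0} α ∈ M` of
  `DualGroup.lean` — note `b.flip.twoRho` sums over `b.flip.IsPos`, the positivity of *coroots*,
  whereas `twoRhoCoroot` sums the coroots of the `b`-positive *roots*; `twoRho` is defined under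
  `open scoped Classical`, so unfolding both side by side needs `Finset.filter_congr_decidable`)
  and **`RootPairing.Base.root'_twoRhoCoroot`: `⟨α, ∑_{β > 0} β^∨⟩ = 2 ht(α)`** for every root
  `α` of a finite reduced root pairing over `ℤ` (proved: a simple reflection `s_j` permutes the
  positive roots other than `α_j`, Mathlib `RootPairing.Base.IsPos.reflectionPerm`, so
  `s_j(y) = y - 2α_j^∨` and `⟨α_j, y⟩ = 2`; then linearity and `height_eq_sum`; Bourbaki,
  *Lie* VI §1.10, Prop. 29, in dual form). Hence `y = ∑_{β > 0} β^∨` is regular with `R⁺(y)`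
  the `b`-positive roots (`root'_twoRhoCoroot_pos_iff`, `root'_twoRhoCoroot_ne_zero`).
* `posRootGroup_twoRhoCoroot`: `U(y) = ⨆_{b.IsPos i} u_i(𝔾ₐ)`;
  `borelOfBase_eq_sup_posRootGroup` (granted 8.1.1 (i)): `B(b) = T ⊔ U(y)`. (Closedness and
  connectedness of such joins are already in the tree unconditionally: `isZConnected_iSup`,
  Springer 2.2.7 (i), and `isAlgebraicSubgroup_borelOfBase_holds` of
  `ReductiveDualChevalleyBasedProofs.lean`.)

## References

* T. A. Springer, *Linear Algebraic Groups*, 2nd ed. (1998) [SpringerLAG1998]: 7.4.5, 8.2.1,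
  8.2.4 (i) and its proof.
* N. Bourbaki, *Groupes et algèbres de Lie*, Ch. VI, §1.10, Prop. 29.
-/

open scoped MatrixGroups IsMulCommutative

noncomputable section

/-! ### The sum of the positive coroots -/

namespace RootPairing.Base

section General

variable {ι R M N : Type*} [CommRing R] [CharZero R] [AddCommGroup M] [Module R M]
  [AddCommGroup N] [Module R N] {P : RootPairing ι R M N} (b : P.Base)

/-- Positivity of a root with respect to a base is decidable (`0 < height`). [folklore] -/
instance decidableIsPos : DecidablePred b.IsPos := fun i =>
  inferInstanceAs (Decidable (0 < b.height i))

/-- The sum `2ρ^∨ = ∑_{β > 0} β^∨ ∈ N` of the coroots indexed by the `b`-positive roots (twice the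
half-sum of the positive coroots; Bourbaki, *Lie* VI §1.10). Coroot-side twin of
`RootPairing.Base.twoRho` (`DualGroup.lean`); deliberate dot-notation extension of Mathlib's
`RootPairing.Base`. [folklore] -/
def twoRhoCoroot [Fintype ι] : N :=
  ∑ i ∈ Finset.univ.filter (fun i => b.IsPos i), P.coroot i

end General

variable {ι X Y : Type*} [AddCommGroup X] [AddCommGroup Y] {P : RootPairing ι ℤ X Y} (b : P.Base)

/-- **`⟨α_j, ∑_{β > 0} β^∨⟩ = 2` for a simple root `α_j`**: the simple reflection `s_j` permutes
the positive roots other than `α_j` (Mathlib `RootPairing.Base.IsPos.reflectionPerm`) and sends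
`α_j^∨` to `-α_j^∨`, so `s_j(y) = y - 2 α_j^∨` for `y = ∑_{β > 0} β^∨`, while
`s_j(y) = y - ⟨α_j, y⟩ α_j^∨` (Bourbaki, *Lie* VI §1.10, Prop. 29). [folklore] -/
theorem root'_twoRhoCoroot_of_mem_support [Fintype ι] [P.IsReduced] {j : ι} (hj : j ∈ b.support) :
    P.root' j b.twoRhoCoroot = 2 := by
  classical
  set S : Finset ι := Finset.univ.filter (fun i => b.IsPos i) with hS
  have hjS : j ∈ S := by simpa [hS] using b.isPos_of_mem_support hj
  -- `s_j (∑_{i ∈ S} α_i^∨) = ∑_{i ∈ S} α_{s_j i}^∨`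
  have h1 : P.coreflection j b.twoRhoCoroot = ∑ i ∈ S, P.coroot (P.reflectionPerm j i) := by
    rw [twoRhoCoroot, map_sum]
    exact Finset.sum_congr rfl fun i _ => (P.coroot_reflectionPerm j i).symm
  -- reindex the sum over `S \ {j}` by the involution `s_j`
  have hmem : ∀ i ∈ S.erase j, P.reflectionPerm j i ∈ S.erase j := by
    intro i hi
    obtain ⟨hij, hiS⟩ := Finset.mem_erase.mp hi
    have hipos : b.IsPos i := by simpa [hS] using hiS
    refine Finset.mem_erase.mpr ⟨fun h => ?_, ?_⟩
    · -- `s_j i = j` forces `i = s_j j`, a negative root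
      have : i = P.reflectionPerm j j := by
        have h' := P.reflectionPerm_self j i
        rw [h] at h'
        exact h'.symm
      have hneg : P.coroot i = -P.coroot j := by
        rw [this, P.coroot_reflectionPerm, P.coreflection_apply_self]
      -- heights: `α_i` positive but `α_i = -α_j`
      have hri : P.root i = -P.root j := by
        rw [this, P.root_reflectionPerm, P.reflection_apply_self]
      have hh := b.height_add_zsmul (i := j) (j := j) (k := i) (z := -2)
        (by rw [hri]; module)
      have hjpos := b.isPos_of_mem_support hj
      rw [RootPairing.Base.IsPos] at hipos hjpos
      simp only [smul_eq_mul] at hh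
      omega
    · simpa [hS] using hipos.reflectionPerm hj hij
  have h2 : ∑ i ∈ S.erase j, P.coroot (P.reflectionPerm j i) = ∑ i ∈ S.erase j, P.coroot i :=
    Finset.sum_nbij' (fun i => P.reflectionPerm j i) (fun i => P.reflectionPerm j i) hmem hmem
      (fun i _ => P.reflectionPerm_self j i) (fun i _ => P.reflectionPerm_self j i) (fun _ _ => rfl)
  -- hence `s_j y = y - 2 α_j^∨`
  have h3 : P.coreflection j b.twoRhoCoroot = b.twoRhoCoroot - (2 : ℤ) • P.coroot j := by
    rw [h1, ← Finset.add_sum_erase S _ hjS, h2, P.coroot_reflectionPerm, P.coreflection_apply_self]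
    have hy : b.twoRhoCoroot = P.coroot j + ∑ i ∈ S.erase j, P.coroot i := by
      rw [twoRhoCoroot, ← Finset.add_sum_erase S _ hjS]
    rw [hy]
    module
  -- compare with `s_j y = y - ⟨α_j, y⟩ α_j^∨` and pair with `α_j`
  rw [P.coreflection_apply] at h3
  have h4 : (P.root' j b.twoRhoCoroot) • P.coroot j = (2 : ℤ) • P.coroot j := by
    have := congrArg (fun z => b.twoRhoCoroot - z) h3
    simpa using this
  have h5 := congrArg (fun z => P.root' j z) h4
  simp only [map_zsmul, smul_eq_mul, RootPairing.root'_coroot_eq_pairing,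
    RootPairing.pairing_same] at h5
  omega

/-- **`⟨α, ∑_{β > 0} β^∨⟩ = 2 ht(α)` for every root `α`**: write `α = ∑ f_j α_j` over the simple
roots (`RootPairing.Base.exists_root_eq_sum_int`, `height_eq_sum`) and use the simple case.
[folklore] -/
theorem root'_twoRhoCoroot [Fintype ι] [P.IsReduced] (i : ι) :
    P.root' i b.twoRhoCoroot = 2 * b.height i := by
  obtain ⟨f, -, -, hf⟩ := b.exists_root_eq_sum_int i
  rw [b.height_eq_sum hf]
  change P.toLinearMap (P.root i) b.twoRhoCoroot = _
  rw [hf, map_sum, LinearMap.sum_apply, Finset.mul_sum]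
  refine Finset.sum_congr rfl fun j hj => ?_
  rw [map_zsmul, LinearMap.smul_apply, smul_eq_mul]
  change f j * P.root' j b.twoRhoCoroot = _
  rw [b.root'_twoRhoCoroot_of_mem_support hj, mul_comm]

/-- The coweight `∑_{β > 0} β^∨` is regular, and its positive system is that of `b`:
`⟨α, y⟩ > 0 ↔ α` is `b`-positive. [folklore] -/
theorem root'_twoRhoCoroot_pos_iff [Fintype ι] [P.IsReduced] (i : ι) :
    0 < P.root' i b.twoRhoCoroot ↔ b.IsPos i := by
  rw [b.root'_twoRhoCoroot i, RootPairing.Base.IsPos]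
  omega

/-- No root vanishes on `∑_{β > 0} β^∨`. [folklore] -/
theorem root'_twoRhoCoroot_ne_zero [Fintype ι] [P.IsReduced] (i : ι) :
    P.root' i b.twoRhoCoroot ≠ 0 := by
  rw [b.root'_twoRhoCoroot i]
  have := b.height_ne_zero i
  omega

end RootPairing.Base

/-! ### The unipotent part of `B(b)` -/

namespace Literature.NumberTheory.Automorphic

variable {k : Type*} [Field k] {n : Type*} [Fintype n] [DecidableEq n]
variable {ι X Y : Type*} [AddCommGroup X] [AddCommGroup Y]
variable {G T : Subgroup (GL n k)} [IsMulCommutative ↥T]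
variable {P : RootPairing ι ℤ X Y} {eX : Additive ↥(characterLattice T) ≃+ X}
  {eY : Additive ↥(cocharacterLattice T) ≃+ Y}

/-- For the regular coweight `y = ∑_{β > 0} β^∨` of a base `b`, `U(y)` is generated by the root
homomorphisms of the `b`-positive roots. [folklore] -/
theorem posRootGroup_twoRhoCoroot [Fintype ι] [P.IsReduced] (b : P.Base)
    (u : ι → Multiplicative k →* ↥G) :
    posRootGroup G P u b.twoRhoCoroot = ⨆ (i : ι) (_ : b.IsPos i), (u i).range.map G.subtype := by
  refine le_antisymm (iSup_le fun i => ?_) (iSup_le fun i => iSup_le fun hi => ?_)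
  · exact le_iSup_of_le (f := fun i : ι => ⨆ (_ : b.IsPos i), (u i).range.map G.subtype) i.1
      (le_iSup_of_le (f := fun _ : b.IsPos i.1 => (u i.1).range.map G.subtype)
        ((b.root'_twoRhoCoroot_pos_iff i.1).mp i.2) le_rfl)
  · exact le_iSup_of_le (f := fun i : {i : ι // 0 < P.root' i b.twoRhoCoroot} =>
      (u i.1).range.map G.subtype) ⟨i, (b.root'_twoRhoCoroot_pos_iff i).mpr hi⟩ le_rfl

/-- `B(b) = T ⊔ U(y)` for `y = ∑_{β > 0} β^∨` and root homomorphisms `u_i` of all roots, granted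
8.1.1 (i). [folklore] -/
theorem borelOfBase_eq_sup_posRootGroup [IsAlgClosed k] [Fintype ι] [P.IsReduced]
    (h811 : rootSubgroup_unique (G := G) (T := T))
    (hG : IsConnectedReductive G) (hT : IsMaximalTorusIn T G) (h : IsRootDatumOf G T P eX eY)
    {u : ι → Multiplicative k →* ↥G}
    (hu : ∀ i, IsRootHom G T h.le (charOfWeight eX (P.root i)) (u i)) (b : P.Base) :
    borelOfBase G T P b eX = T ⊔ posRootGroup G P u b.twoRhoCoroot := by
  rw [borelOfBase_def, posRootGroup_twoRhoCoroot b u]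
  congr 1
  exact iSup_congr fun i => iSup_congr fun _ => (map_range_eq_rootSubgroup h811 hG hT h hu i).symm

end Literature.NumberTheory.Automorphic

end
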